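import Mathlib
import Literature.NumberTheory.Transcendental.AssociatorsPairing
import Literature.NumberTheory.Transcendental.AssociatorsTwoCycle
import HarnessLib

/-!
# Evaluation of the bar elements at Furusho's point `φ₄₅₁ φ₁₂₃` (Furusho 2011, §5)

Sibling file of `Associators.lean` (Part B.5b of the proof of `furusho_pentagon_doubleShuffle`
[Furusho2011, Thm 1.2]); everything is proved, no named facts. For a group-like solution `φ` of
Drinfeld's pentagon equation over a commutative `ℚ`-algebra `K` we prove the **stuffle relation of
the `Y`-projection off the corner**:

  `π_Y(φ)(s) · π_Y(φ)(t) = Σ_{u ∈ s ∗ t} π_Y(φ)(u)`  for `s` admissible nonempty and `t` with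
  positive entries nonempty (`NCSeries.DrinfeldPentagon.piY_mul_piY_eq_sum_stuffle`),

which is the coefficientwise content of [Furusho2011, Lemmas 5.1, 5.2 and the display after (5.3)]
("`l_𝐚(φ) l_𝐛(φ) = Σ_{σ ∈ Sh^≤(k,l)} l_{σ(𝐚,𝐛)}(φ)` whenever `b_1 > 1`"). Architecture (the printed
proof, made algebraic):

1. **The evaluation functionals.** For a substitution table `m` (`X₀, X₁ ↦` signed sums of the five
   letters `α₀, α₁, β₀, β₁, γ` dual to Furusho's `P', Q', R', S', T'`), `⟨L, push m φ⟩_W` is the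
   weight-`W` coefficient pairing of a bar functional `L` with the image of `φ` (`pairLen`, `push` of
   `AssociatorsPairing.lean`). Furusho's `E₁(L) = l(φ₄₅₁ φ₁₂₃)` is the pairing with
   `Ĝ₁ = push m_{de} φ · push m_{ab} φ` and `E₂(L) = l(φ₄₃₂ φ₂₁₅ φ₅₄₃)` the pairing with
   `Ĝ₂ = push m_{cb} φ · push m_{ae} φ · push m_{dc} φ`, where `a = t₁₂, b = t₂₃, c = t₃₄,
   d = t₁₂ + t₁₃ + t₂₃ (= X₄₅), e = t₂₃ + t₂₄ + t₃₄ (= X₅₁)` in `U𝔞₄ ≅ U𝔓₅` and the tables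
   `m_{uv}` record `⟨form, u⟩, ⟨form, v⟩`.
2. **Lemma 5.1** (`E₁(l^x_𝐚) = l_𝐚(φ)`, `E₁(l^y_𝐛) = l_𝐛(φ)`, `E₁(l^{xy}) , E₁(l^{x,y})` are the
   corresponding coefficients of `φ`): by the coefficient recursions of the bar elements
   (`BarFun.der_*` of `AssociatorsBar.lean`) against `c_{f x}(push m φ) = Σ_b m(b,f) c_x(push m ∂_b φ)`;
   the key computation `⟨l^{x,y}_{s,t}, push m_{de} φ⟩ = π_Y(φ)(t s)` (`pairLen_lxy_pushDE`) is a
   weight induction in which the two `α₁`-components cancel.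
3. **Lemma 5.2** (`E₂(l^{y,x}_{𝐚,𝐛}) = l_{𝐛𝐚}(φ)` for `b_1 > 1`): the factors `φ(c,b)` and `φ(d,c)`
   only produce words in `{α₁,β₁}` resp. `{β₀,β₁}`, which pair to zero with `l^{y,x}` by the prefix
   property [Furusho2011, "N.B." before Lemma 5.2] and the last-letter property, except through
   the pure powers `c_{X₀ⁿ}(φ) = 0`.
4. **`E₁ = E₂` on integrable functionals** (Chen's theory in the source): here the finite-dimensional
   representation `ρ_N` of the truncated Drinfeld–Kohno algebra `U𝔞₄/(deg > N)` on integrable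
   functionals of weight `≤ N` by right-appending letters (`DrinfeldKohnoTrunc.Compatible.lift` of
   `AssociatorsProofs.lean`; the infinitesimal braid relations hold because integrable functionals
   kill the six quadratic relations of `U𝔓₅`, `BarFun.Integrable`), applied to the identity
   `φ(d,e) φ(a,b) = φ(c,b) φ(a,e) φ(d,c)` in `U𝔞₄` (`DrinfeldPentagon.eval_point_eq`, from the
   pentagon and the 2-cycle relation).
5. **Assembly**: multiplicativity of `E₁` on group-like series (`pairLen_shufK_homog`, the duality
   `ш ↔ Δ`) and the series shuffle formula `l^x_𝐚 ш l^y_𝐛 = Q(𝐚, 𝐛)` (`BarFun.shuf_lx_ly`).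

## References

* H. Furusho, *Double shuffle relation for associators*, Ann. of Math. 174 (2011), 341–360, §5,
  Lemmas 5.1, 5.2, eq. (5.3). [Furusho2011]
* H. Furusho, *Pentagon and hexagon equations*, Ann. of Math. 171 (2010), 545–556, Lemmas 5, 6.
  [Furusho2010]
-/

noncomputable section

open scoped BigOperators

namespace Literature.NumberTheory.Transcendental

universe u v

/-! ## B.5b.1 Coefficient recursions for `π_Y` -/

namespace NCSeries

variable {K : Type v} [CommRing K]

/-- `binaryWord ((d+2) r) = 0 · binaryWord ((d+1) r)`. [folklore] -/
theorem binaryWord_succ_succ_cons (d : ℕ) (r : List ℕ) :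
    MZV.binaryWord ((d + 2) :: r) = false :: MZV.binaryWord ((d + 1) :: r) := by
  simp only [MZV.binaryWord, show d + 2 - 1 = d + 1 by omega, show d + 1 - 1 = d by omega,
    List.replicate_succ, List.cons_append]

/-- `binaryWord (1 r) = 1 · binaryWord r`. [folklore] -/
theorem binaryWord_one_cons (r : List ℕ) : MZV.binaryWord (1 :: r) = true :: MZV.binaryWord r := by
  simp [MZV.binaryWord]

/-- `π_Y(φ)((d+2) r) = π_Y(∂₀ φ)((d+1) r)` on positive indices. [folklore] -/
theorem piY_succ_succ_cons (φ : NCSeries Bool K) (d : ℕ) {r : List ℕ} (hr : ∀ i ∈ r, 1 ≤ i) :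
    piY φ ((d + 2) :: r) = piY (lderiv false φ) ((d + 1) :: r) := by
  rw [piY_apply_of_forall_pos φ (List.forall_mem_cons.mpr ⟨by omega, hr⟩),
    piY_apply_of_forall_pos _ (List.forall_mem_cons.mpr ⟨by omega, hr⟩), binaryWord_succ_succ_cons,
    lderiv_apply, List.length_cons, List.length_cons]

/-- `π_Y(φ)(1 r) = -π_Y(∂₁ φ)(r)` on positive indices. [folklore] -/
theorem piY_one_cons (φ : NCSeries Bool K) {r : List ℕ} (hr : ∀ i ∈ r, 1 ≤ i) :
    piY φ (1 :: r) = -piY (lderiv true φ) r := by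
  rw [piY_apply_of_forall_pos φ (List.forall_mem_cons.mpr ⟨le_rfl, hr⟩),
    piY_apply_of_forall_pos _ hr, binaryWord_one_cons, lderiv_apply, List.length_cons, pow_succ]
  ring

end NCSeries

/-! ## B.5b.2 Pairings with pushforwards: one-step recursion -/

section PairPush

variable {α : Type u} {K : Type v} [CommRing K] [Fintype α] {β : Type*} [Fintype β]

/-- The pairing with `0` vanishes. [folklore] -/
@[simp] theorem pairLen_zero_left (n : ℕ) (G : NCSeries α K) : pairLen n (0 : List α → K) G = 0 := by
  simp [pairLen]

/-- The pairing is linear in the series: weighted finite sums. [folklore] -/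
theorem pairLen_sum_smul_right {ι : Type*} (s : Finset ι) (n : ℕ) (ψ : List α → K) (c : ι → K)
    (G : ι → NCSeries α K) :
    pairLen n ψ (∑ i ∈ s, c i • G i) = ∑ i ∈ s, c i * pairLen n ψ (G i) := by
  classical
  induction s using Finset.induction_on with
  | empty => simp [pairLen]
  | insert _ _ hi ih =>
    rw [Finset.sum_insert hi, Finset.sum_insert hi, pairLen_add_right, pairLen_smul_right, ih]

/-- **One step of the pairing with a pushforward**:
`⟨ψ, push m φ⟩_{n+1} = Σ_f Σ_b m(b,f) ⟨∂_f ψ, push m (∂_b φ)⟩_n`. [folklore] -/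
theorem pairLen_succ_push (n : ℕ) (ψ : List α → K) (m : β → α → K) (φ : NCSeries β K) :
    pairLen (n + 1) ψ (NCSeries.push m φ) =
      ∑ f : α, ∑ b : β, m b f * pairLen n (derK f ψ) (NCSeries.push m (NCSeries.lderiv b φ)) := by
  rw [pairLen_succ]
  refine Finset.sum_congr rfl fun f _ => ?_
  rw [NCSeries.lderiv_push, pairLen_sum_smul_right]

end PairPush

namespace BarFun

open F5 NCSeries

variable {K : Type v} [CommRing K]

/-! ## B.5b.3 The substitution tables of Furusho's evaluation points -/

/-- Table of `(d, e) = (X₄₅, X₅₁) = (t₁₂+t₁₃+t₂₃, t₂₃+t₂₄+t₃₄)`: `⟨β₀, d⟩ = 1`,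
`⟨α₁, e⟩ = ⟨β₁, e⟩ = ⟨γ, e⟩ = -1`, all other pairings `0`. [cite: Furusho2011, §5 (proof of Lemma 5.1)] -/
def preDE : F5 → Option (Bool × K)
  | a0 => none
  | a1 => some (true, -1)
  | b0 => some (false, 1)
  | b1 => some (true, -1)
  | g => some (true, -1)

/-- Table of `(a, b) = (X₁₂, X₂₃) = (t₁₂, t₂₃)`: `⟨α₀, a⟩ = 1`, `⟨α₁, b⟩ = -1`.
[cite: Furusho2011, §5 (proof of Lemma 5.1)] -/
def preAB : F5 → Option (Bool × K)
  | a0 => some (false, 1)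
  | a1 => some (true, -1)
  | _ => none

/-- Table of `(c, b) = (X₃₄, X₂₃)`: `⟨β₁, c⟩ = -1`, `⟨α₁, b⟩ = -1`.
[cite: Furusho2011, §5 (proof of Lemma 5.2)] -/
def preCB : F5 → Option (Bool × K)
  | b1 => some (false, -1)
  | a1 => some (true, -1)
  | _ => none

/-- Table of `(a, e) = (X₁₂, X₅₁)`: `⟨α₀, a⟩ = 1`, `⟨α₁, e⟩ = ⟨β₁, e⟩ = ⟨γ, e⟩ = -1`.
[cite: Furusho2011, §5 (proof of Lemma 5.2)] -/
def preAE : F5 → Option (Bool × K)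
  | a0 => some (false, 1)
  | a1 => some (true, -1)
  | b0 => none
  | b1 => some (true, -1)
  | g => some (true, -1)

/-- Table of `(d, c) = (X₄₅, X₃₄)`: `⟨β₀, d⟩ = 1`, `⟨β₁, c⟩ = -1`.
[cite: Furusho2011, §5 (proof of Lemma 5.2)] -/
def preDC : F5 → Option (Bool × K)
  | b0 => some (false, 1)
  | b1 => some (true, -1)
  | _ => none

/-- The substitution `m_{de}`. [folklore] -/
abbrev mDE : Bool → F5 → K := monoSubst preDE
/-- The substitution `m_{ab}`. [folklore] -/
abbrev mAB : Bool → F5 → K := monoSubst preAB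
/-- The substitution `m_{cb}`. [folklore] -/
abbrev mCB : Bool → F5 → K := monoSubst preCB
/-- The substitution `m_{ae}`. [folklore] -/
abbrev mAE : Bool → F5 → K := monoSubst preAE
/-- The substitution `m_{dc}`. [folklore] -/
abbrev mDC : Bool → F5 → K := monoSubst preDC

/-- The double sum `Σ_f Σ_b m_{de}(b,f) X(f,b)` made explicit. [folklore] -/
theorem sum_mDE (X : F5 → Bool → K) :
    ∑ f : F5, ∑ b : Bool, (mDE b f : K) * X f b = X b0 false - X a1 true - X b1 true - X g true := by
  rw [sum_F5]
  simp only [Fintype.sum_bool, mDE, monoSubst, preDE]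
  simp
  ring

/-- The double sum `Σ_f Σ_b m_{ab}(b,f) X(f,b)` made explicit. [folklore] -/
theorem sum_mAB (X : F5 → Bool → K) :
    ∑ f : F5, ∑ b : Bool, (mAB b f : K) * X f b = X a0 false - X a1 true := by
  rw [sum_F5]
  simp only [Fintype.sum_bool, mAB, monoSubst, preAB]
  simp
  ring

/-- `m_{ae} ∘ sw = m_{de}` (exchanging `x ↔ y` exchanges `(a, e) ↔ (d, e)`-tables as needed for
`l^{y,x} = swap(l^{x,y})`). [folklore] -/
theorem mAE_sw (b : Bool) (f : F5) : (mAE b (sw f) : K) = mDE b f := by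
  cases b <;> cases f <;> simp [mAE, mDE, monoSubst, preAE, preDE, sw]

/-! ## B.5b.4 Lemma 5.1: `⟨l^{x,y}_{s,t}, φ(d, e)⟩ = π_Y(φ)(t s)` -/

/-- The pairing of `castK 0` vanishes. [folklore] -/
theorem pairLen_castK_zero (n : ℕ) (G : NCSeries F5 K) : pairLen n (castK (K := K) 0) G = 0 := by
  rw [castK_zero, pairLen_zero_left]

/-- One step of `⟨L, push m_{de} φ⟩`: only the `β₀`-component (against `∂₀φ`) and the
`α₁, β₁, γ`-components (against `-∂₁φ`) are seen by `(d, e)`. [folklore] -/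
theorem pairLen_succ_castK_pushDE (W : ℕ) (L : BarFun) (φ : NCSeries Bool K) :
    pairLen (W + 1) (castK L) (push mDE φ) =
      pairLen W (castK (K := K) (der b0 L)) (push mDE (lderiv false φ)) -
        pairLen W (castK (K := K) (der a1 L)) (push mDE (lderiv true φ)) -
        pairLen W (castK (K := K) (der b1 L)) (push mDE (lderiv true φ)) -
        pairLen W (castK (K := K) (der g L)) (push mDE (lderiv true φ)) := by
  rw [pairLen_succ_push,
    sum_mDE fun f b => pairLen W (derK f (castK (K := K) L)) (push mDE (lderiv b φ))]
  simp only [derK_castK]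

/-- `l⁻ (last(l) s) = l s` for a nonempty list `l`. [folklore] -/
theorem dropLast_append_getLast_cons (l s : List ℕ) (h : l ≠ []) :
    l.dropLast ++ (l.getLast h :: s) = l ++ s := by
  conv_rhs => rw [← List.dropLast_append_getLast h]
  rw [List.append_assoc, List.singleton_append]

/-- The `α₁`-component of `l^{x,y}_{s,(d+1)q}` pairs to zero with every `push m_{de} φ'`, given the
key computation in smaller size (the two terms `l_{s',t}` and `l_{(s',b_l),t'}` of
`∂_{α₁} l_{(1,s'),t}` have the same index word `t s'`). [folklore] -/
theorem pairLen_der_a1_lxy_pushDE (n : ℕ)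
    (ih : ∀ (s t : List ℕ), (∀ i ∈ s, 1 ≤ i) → (∀ i ∈ t, 1 ≤ i) → msz s t ≤ n →
      ∀ φ : NCSeries Bool K, pairLen (s.sum + t.sum) (castK (lxy s t)) (push mDE φ) = piY φ (t ++ s))
    (s : List ℕ) (hs : ∀ i ∈ s, 1 ≤ i) (d : ℕ) {q : List ℕ} (hq : ∀ i ∈ q, 1 ≤ i)
    (hmn : msz s ((d + 1) :: q) ≤ n + 1) (φ' : NCSeries Bool K) {W : ℕ}
    (hW : W = s.sum + d + q.sum) :
    pairLen W (castK (K := K) (der a1 (lxy s ((d + 1) :: q)))) (push mDE φ') = 0 := by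
  match s, hs, hmn, hW with
  | [], _, _, _ => rw [lxy_nil_left, der_ly_eq_zero ⟨by decide, by decide⟩, pairLen_castK_zero]
  | 0 :: _, hs, _, _ => exact absurd (hs 0 (by simp)) (by omega)
  | (c + 2) :: s', _, _, _ => rw [der_a1_lxy_two, pairLen_castK_zero]
  | 1 :: s', hs, hmn, hW =>
    have hs' : ∀ i ∈ s', 1 ≤ i := fun i hi => hs i (by simp [hi])
    rw [der_a1_lxy_one, castK_sub, pairLen_sub_left]
    obtain ⟨hb1, ht'⟩ := pos_cons_getLast_dropLast hq d
    have hsum := sum_dropLast_add_getLast ((d + 1) :: q) (List.cons_ne_nil _ _)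
    have hlen : ((d + 1) :: q).dropLast.length + 1 = q.length + 1 := by
      rw [List.length_dropLast]; simp
    simp only [msz, List.sum_cons, List.length_cons] at hmn
    have h1 := ih s' ((d + 1) :: q) hs' (List.forall_mem_cons.mpr ⟨by omega, hq⟩)
      (by simp only [msz, List.sum_cons, List.length_cons]; omega) φ'
    have h2 := ih (((d + 1) :: q).getLast (List.cons_ne_nil _ _) :: s') ((d + 1) :: q).dropLast
      (List.forall_mem_cons.mpr ⟨hb1, hs'⟩) ht'
      (by simp only [msz, List.sum_cons, List.length_cons] at hsum ⊢; omega) φ'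
    have e1 : s'.sum + ((d + 1) :: q).sum = W := by
      simp only [List.sum_cons] at hW ⊢; omega
    have e2 : (((d + 1) :: q).getLast (List.cons_ne_nil _ _) :: s').sum +
        ((d + 1) :: q).dropLast.sum = W := by
      simp only [List.sum_cons] at hsum hW ⊢; omega
    rw [e1] at h1
    rw [e2, dropLast_append_getLast_cons _ _ (List.cons_ne_nil _ _)] at h2
    rw [h1, h2, sub_self]

/-- **Key computation** [Furusho2011, Lemma 5.1, "by the completely same arguments …, we obtain
`E₁(l^{x,y}_{𝐚,𝐛}) = l_{𝐚,𝐛}(φ)`"; here with `φ(d, e)` alone, to which `E₁` reduces on these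
functionals]: for indices with positive entries,
`⟨l^{x,y}_{s,t}, push m_{de} φ⟩_{|s|+|t|} = π_Y(φ)(t s)` (list convention: `t s` is `t ++ s`,
the reversed Furusho word `𝐚𝐛`). The proof is the weight induction on the bar recursions: the
`β₀`/`β₁`/`γ`-components reproduce the recursion of `π_Y`, the `α₀`-component is not seen by
`(d, e)`, and the two `α₁`-components `l_{s',t} - l_{(s',b_l),t'}` have the same value. It covers
`l^y_t` (`s = ∅`) and `l^{xy}_s` (`t = ∅`). [cite: Furusho2011, Lemma 5.1] -/
theorem pairLen_lxy_pushDE : ∀ (n : ℕ) (s t : List ℕ), (∀ i ∈ s, 1 ≤ i) → (∀ i ∈ t, 1 ≤ i) →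
    msz s t ≤ n → ∀ φ : NCSeries Bool K,
      pairLen (s.sum + t.sum) (castK (lxy s t)) (push mDE φ) = piY φ (t ++ s) := by
  intro n
  induction n with
  | zero =>
    intro s t hs ht hn φ
    have hs0 : s = [] := by
      cases s with
      | nil => rfl
      | cons a w => simp [msz] at hn
    have ht0 : t = [] := by
      cases t with
      | nil => rfl
      | cons a w => simp [msz] at hn
    subst hs0; subst ht0
    simp [lxy_nil_left]
  | succ n ih =>
    intro s t hs ht hn φ
    match s, t, hs, ht, hn with
    | [], [], _, _, _ => simp [lxy_nil_left]
    | 0 :: _, _, hs, _, _ => exact absurd (hs 0 (by simp)) (by omega)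
    | _, 0 :: _, _, ht, _ => exact absurd (ht 0 (by simp)) (by omega)
    | 1 :: s', [], hs, _, hn =>
      have hs' : ∀ i ∈ s', 1 ≤ i := fun i hi => hs i (by simp [hi])
      simp only [msz, List.sum_cons, List.length_cons, List.sum_nil, List.length_nil] at hn
      rw [lxy_nil_right, List.nil_append,
        show (1 :: s').sum + ([] : List ℕ).sum = s'.sum + 1 by simp; omega,
        pairLen_succ_castK_pushDE, der_lxyD_one, der_lxyD_one, der_lxyD_one, der_lxyD_one,
        if_neg (by decide), if_neg (by decide), if_neg (by decide), if_pos rfl]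
      simp only [pairLen_castK_zero, zero_sub, sub_zero]
      have h := ih s' [] hs' (by simp) (by simp only [msz, List.sum_nil, List.length_nil]; omega)
        (lderiv true φ)
      rw [lxy_nil_right', List.nil_append, List.sum_nil, add_zero] at h
      rw [h, piY_one_cons φ hs']
    | (c + 2) :: s', [], hs, _, hn =>
      have hs' : ∀ i ∈ s', 1 ≤ i := fun i hi => hs i (by simp [hi])
      simp only [msz, List.sum_cons, List.length_cons, List.sum_nil, List.length_nil] at hn
      rw [lxy_nil_right, List.nil_append,
        show ((c + 2) :: s').sum + ([] : List ℕ).sum = ((c + 1) :: s').sum + 1 by simp; omega,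
        pairLen_succ_castK_pushDE, der_lxyD_two, der_lxyD_two, der_lxyD_two, der_lxyD_two,
        if_pos (Or.inr rfl), if_neg (by decide), if_neg (by decide), if_neg (by decide)]
      simp only [pairLen_castK_zero, sub_zero]
      have h := ih ((c + 1) :: s') [] (List.forall_mem_cons.mpr ⟨by omega, hs'⟩) (by simp)
        (by simp only [msz, List.sum_cons, List.length_cons, List.sum_nil, List.length_nil]; omega)
        (lderiv false φ)
      rw [lxy_nil_right, List.nil_append, List.sum_nil, add_zero] at h
      rw [h, piY_succ_succ_cons φ c hs']
    | s, (d + 1) :: t'', hs, ht, hn =>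
      have ht'' : ∀ i ∈ t'', 1 ≤ i := fun i hi => ht i (by simp [hi])
      have hts : ∀ i ∈ t'' ++ s, 1 ≤ i := fun i hi => by
        rcases List.mem_append.mp hi with h | h
        · exact ht'' i h
        · exact hs i h
      rw [show s.sum + ((d + 1) :: t'').sum = (s.sum + d + t''.sum) + 1 by simp; omega,
        pairLen_succ_castK_pushDE, pairLen_der_a1_lxy_pushDE n ih s hs d ht'' hn _ rfl,
        der_g_lxy_right_succ, pairLen_castK_zero, sub_zero, sub_zero]
      match d, ht, hn, hts with
      | 0, _, hn, hts =>
        rw [der_b0_lxy_right_one, der_b1_lxy_right_one, pairLen_castK_zero, zero_sub]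
        have h := ih s t'' hs ht'' (by simp only [msz, List.sum_cons, List.length_cons] at hn ⊢; omega)
          (lderiv true φ)
        rw [show s.sum + t''.sum = s.sum + 0 + t''.sum by simp] at h
        rw [h, List.cons_append, piY_one_cons φ hts]
      | d₀ + 1, _, hn, hts =>
        rw [der_b0_lxy_right_two, der_b1_lxy_right_two, pairLen_castK_zero, sub_zero]
        have h := ih s ((d₀ + 1) :: t'') hs (List.forall_mem_cons.mpr ⟨by omega, ht''⟩)
          (by simp only [msz, List.sum_cons, List.length_cons] at hn ⊢; omega) (lderiv false φ)
        rw [show s.sum + ((d₀ + 1) :: t'').sum = s.sum + (d₀ + 1) + t''.sum by simp; omega] at h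
        rw [h, List.cons_append, List.cons_append, piY_succ_succ_cons φ d₀ hts]

/-- The key computation, packaged: `⟨l^{x,y}_{s,t}, push m_{de} φ⟩ = π_Y(φ)(t s)`.
[cite: Furusho2011, Lemma 5.1] -/
theorem pairLen_lxy_pushDE' {s t : List ℕ} (hs : ∀ i ∈ s, 1 ≤ i) (ht : ∀ i ∈ t, 1 ≤ i)
    (φ : NCSeries Bool K) :
    pairLen (s.sum + t.sum) (castK (lxy s t)) (push mDE φ) = piY φ (t ++ s) :=
  pairLen_lxy_pushDE _ s t hs ht le_rfl φ

/-! ## B.5b.5 Lemma 5.1 for `l^x`: `⟨l^x_s, φ(a, b)⟩ = π_Y(φ)(s)` -/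

/-- One step of `⟨L, push m_{ab} φ⟩`: the `α₀`-component against `∂₀φ` and the `α₁`-component
against `-∂₁φ`. [folklore] -/
theorem pairLen_succ_castK_pushAB (W : ℕ) (L : BarFun) (φ : NCSeries Bool K) :
    pairLen (W + 1) (castK L) (push mAB φ) =
      pairLen W (castK (K := K) (der a0 L)) (push mAB (lderiv false φ)) -
        pairLen W (castK (K := K) (der a1 L)) (push mAB (lderiv true φ)) := by
  rw [pairLen_succ_push,
    sum_mAB fun f b => pairLen W (derK f (castK (K := K) L)) (push mAB (lderiv b φ))]
  simp only [derK_castK]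

/-- **[Furusho2011, Lemma 5.1, first claim]** in coefficients: `⟨l^x_s, push m_{ab} φ⟩ = π_Y(φ)(s)`
("express `log φ₁₂₃` and `log φ₄₅₁` …; `φ₄₅₁` does not contribute to words in `A, B`").
[cite: Furusho2011, Lemma 5.1] -/
theorem pairLen_lx_pushAB : ∀ (s : List ℕ), (∀ i ∈ s, 1 ≤ i) → ∀ φ : NCSeries Bool K,
    pairLen s.sum (castK (lx s)) (push mAB φ) = piY φ s
  | [], _, φ => by simp
  | 0 :: _, hs, _ => absurd (hs 0 (by simp)) (by omega)
  | 1 :: s', hs, φ => by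
    have hs' : ∀ i ∈ s', 1 ≤ i := fun i hi => hs i (by simp [hi])
    rw [List.sum_cons, add_comm, pairLen_succ_castK_pushAB, der_lx_one, der_lx_one,
      if_neg (by decide), if_pos rfl, pairLen_castK_zero, zero_sub,
      pairLen_lx_pushAB s' hs' (lderiv true φ), piY_one_cons φ hs']
  | (c + 2) :: s', hs, φ => by
    have hs' : ∀ i ∈ s', 1 ≤ i := fun i hi => hs i (by simp [hi])
    have hs1 : ∀ i ∈ (c + 1) :: s', 1 ≤ i := List.forall_mem_cons.mpr ⟨by omega, hs'⟩
    rw [show ((c + 2) :: s').sum = ((c + 1) :: s').sum + 1 by simp; omega, pairLen_succ_castK_pushAB,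
      der_lx_two, der_lx_two, if_pos rfl, if_neg (by decide), pairLen_castK_zero, sub_zero,
      pairLen_lx_pushAB ((c + 1) :: s') hs1 (lderiv false φ), piY_succ_succ_cons φ c hs']
termination_by s => s.sum + s.length
decreasing_by all_goals simp_wf <;> omega

/-! ## B.5b.6 Supports -/

/-- `l^x_s` only sees words in `α₀, α₁`. [folklore] -/
theorem lx_apply_eq_zero_of_mem : ∀ (w : List F5) (s : List ℕ), (∃ f ∈ w, f ≠ a0 ∧ f ≠ a1) →
    lx s w = 0
  | [], _, ⟨_, hf, _⟩ => by simp at hf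
  | x :: w, s, ⟨f, hf, hfa⟩ => by
    show der x (lx s) w = 0
    have hw : x ≠ f → ∃ f ∈ w, f ≠ a0 ∧ f ≠ a1 := fun hx =>
      ⟨f, (List.mem_cons.mp hf).resolve_left (Ne.symm hx), hfa⟩
    match s with
    | [] => rw [lx_nil, der_unit]; rfl
    | 0 :: _ => rw [lx_zero, der_zero]; rfl
    | 1 :: s' =>
      rw [der_lx_one]
      split_ifs with hx
      · exact lx_apply_eq_zero_of_mem w s' (hw (by rw [hx]; exact fun h => hfa.2 h.symm))
      · rfl
    | (c + 2) :: s' =>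
      rw [der_lx_two]
      split_ifs with hx
      · exact lx_apply_eq_zero_of_mem w ((c + 1) :: s') (hw (by rw [hx]; exact fun h => hfa.1 h.symm))
      · rfl

/-- `l^y_s` only sees words in `β₀, β₁`. [folklore] -/
theorem ly_apply_eq_zero_of_mem (w : List F5) (s : List ℕ) (h : ∃ f ∈ w, f ≠ b0 ∧ f ≠ b1) :
    ly s w = 0 := by
  rw [← swapL_lx, swapL_apply]
  refine lx_apply_eq_zero_of_mem _ s ?_
  obtain ⟨f, hf, h0, h1⟩ := h
  refine ⟨sw f, List.mem_map.mpr ⟨f, hf, rfl⟩, ?_, ?_⟩ <;> cases f <;> simp_all [sw]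

/-- **The prefix property** [Furusho2011, "N.B." before Lemma 5.2: for `b_l > 1` the bar word of
`l^{x,y}_{𝐚,𝐛}` contains no term beginning `α₁^r β₁ ⋯`]: in the reversed convention, if `t = ∅`
or the head of `t` is `≥ 2`, then `l^{x,y}_{s,t}` vanishes on every word whose maximal
`{α₁, β₁}`-prefix contains a `β₁`. [cite: Furusho2011, §5 (N.B.)] -/
theorem lxy_apply_prefix_eq_zero : ∀ (x : List F5) (s t : List ℕ) (y : List F5),
    (∀ i ∈ s, 1 ≤ i) → (∀ i ∈ t, 1 ≤ i) → (∀ h : t ≠ [], 2 ≤ t.head h) →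
    (∀ f ∈ x, f = a1 ∨ f = b1) → b1 ∈ x → lxy s t (x ++ y) = 0
  | [], _, _, _, _, _, _, _, hb => by simp at hb
  | f :: x, s, t, y, hs, ht, hh, hx, hb => by
    show der f (lxy s t) (x ++ y) = 0
    have hx' : ∀ f ∈ x, f = a1 ∨ f = b1 := fun f hf => hx f (List.mem_cons_of_mem _ hf)
    rcases hx f (by simp) with rfl | rfl
    · -- `f = α₁`: then `β₁ ∈ x`
      have hb' : b1 ∈ x := by simpa using hb
      match s, t, hs, ht, hh with
      | [], t, _, _, _ => rw [lxy_nil_left, der_ly_eq_zero ⟨by decide, by decide⟩]; rfl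
      | 0 :: _, _, hs, _, _ => exact absurd (hs 0 (by simp)) (by omega)
      | (c + 2) :: s', t, _, _, _ => rw [der_a1_lxy_two]; rfl
      | 1 :: s', [], _, _, _ => rw [lxy_nil_right, der_a1_lxyD]; rfl
      | 1 :: s', 0 :: _, _, ht, _ => exact absurd (ht 0 (by simp)) (by omega)
      | 1 :: s', 1 :: _, _, _, hh => exact absurd (hh (List.cons_ne_nil _ _)) (by simp)
      | 1 :: s', (d + 2) :: q, hs, ht, _ =>
        have hs' : ∀ i ∈ s', 1 ≤ i := fun i hi => hs i (by simp [hi])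
        have hq : ∀ i ∈ q, 1 ≤ i := fun i hi => ht i (by simp [hi])
        obtain ⟨hb1, ht'⟩ := pos_cons_getLast_dropLast hq (d + 1)
        rw [der_a1_lxy_one]
        show lxy s' ((d + 1 + 1) :: q) (x ++ y) -
          lxy (((d + 1 + 1) :: q).getLast (List.cons_ne_nil _ _) :: s') ((d + 1 + 1) :: q).dropLast
            (x ++ y) = 0
        rw [lxy_apply_prefix_eq_zero x s' _ y hs' ht (fun _ => by simp) hx' hb',
          lxy_apply_prefix_eq_zero x _ _ y (List.forall_mem_cons.mpr ⟨hb1, hs'⟩) ht' ?_ hx' hb',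
          sub_zero]
        cases q with
        | nil => simp
        | cons e q' => intro _; simp
    · -- `f = β₁`: `∂_{β₁} l = 0`
      match t, ht, hh with
      | [], _, _ => rw [lxy_nil_right', der_b1_lxyD]; rfl
      | 0 :: _, ht, _ => exact absurd (ht 0 (by simp)) (by omega)
      | 1 :: _, _, hh => exact absurd (hh (List.cons_ne_nil _ _)) (by simp)
      | (d + 2) :: q, _, _ => rw [der_b1_lxy_right_two]; rfl

/-- A word with a letter without preimage is not reached by a monomial substitution.
[folklore] -/
theorem preWord_eq_none_of_mem {α β : Type*} (pre : α → Option (β × K)) :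
    ∀ (x : List α), (∃ f ∈ x, pre f = none) → preWord pre x = none
  | [], ⟨_, hf, _⟩ => by simp at hf
  | f :: x, ⟨f', hf', hn⟩ => by
    rw [preWord]
    rcases List.mem_cons.mp hf' with rfl | h
    · rw [hn]
    · rw [preWord_eq_none_of_mem pre x ⟨f', h, hn⟩]
      cases pre f <;> rfl

/-- `c_x(push m φ) = 0` if a letter of `x` has no preimage under the monomial substitution `m`.
[folklore] -/
theorem push_monoSubst_eq_zero_of_mem {α β : Type*} [Fintype β] [DecidableEq β]
    (pre : α → Option (β × K)) (φ : NCSeries β K) (x : List α) (h : ∃ f ∈ x, pre f = none) :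
    push (monoSubst pre) φ x = 0 := by
  rw [push_monoSubst, preWord_eq_none_of_mem pre x h]

/-- The preimage of a pure power `fᵏ` under a monomial substitution with `pre f = (b, c)` is
`(bᵏ, cᵏ)`. [folklore] -/
theorem preWord_replicate {α β : Type*} (pre : α → Option (β × K)) {f : α} {b : β} {c : K}
    (hf : pre f = some (b, c)) : ∀ k : ℕ,
    preWord pre (List.replicate k f) = some (List.replicate k b, c ^ k)
  | 0 => by simp [preWord]
  | k + 1 => by
    rw [List.replicate_succ, preWord, hf, preWord_replicate pre hf k]
    simp [List.replicate_succ, pow_succ, mul_comm]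

/-- `c_{fᵏ}(push m φ) = cᵏ c_{bᵏ}(φ)` for a monomial substitution with `pre f = (b, c)`.
[folklore] -/
theorem push_monoSubst_replicate {α β : Type*} [Fintype β] [DecidableEq β]
    (pre : α → Option (β × K)) (φ : NCSeries β K) {f : α} {b : β} {c : K}
    (hf : pre f = some (b, c)) (k : ℕ) :
    push (monoSubst pre) φ (List.replicate k f) = c ^ k * φ (List.replicate k b) := by
  rw [push_monoSubst, preWord_replicate pre hf k]

/-- A word all of whose letters equal `f` is a power of `f`. [folklore] -/
theorem eq_replicate_of_forall {α : Type*} {x : List α} {f : α} (h : ∀ f' ∈ x, f' = f) :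
    x = List.replicate x.length f :=
  List.eq_replicate_iff.mpr ⟨rfl, h⟩

/-- A nonempty word is a word followed by a last letter. [folklore] -/
theorem exists_eq_append_singleton {α : Type*} {z : List α} (hz : z ≠ []) :
    ∃ (z' : List α) (l : α), z = z' ++ [l] :=
  ⟨z.dropLast, z.getLast hz, (List.dropLast_append_getLast hz).symm⟩

/-! ## B.5b.7 Pushforwards along `sw` and the `(a, e)`-table -/

/-- `push m φ (sw x) = push (m ∘ sw) φ x`. [folklore] -/
theorem push_map_sw (m : Bool → F5 → K) : ∀ (x : List F5) (φ : NCSeries Bool K),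
    push m φ (x.map sw) = push (fun b f => m b (sw f)) φ x
  | [], φ => rfl
  | f :: x, φ => by
    rw [List.map_cons, push_cons, push_cons]
    exact Finset.sum_congr rfl fun b _ => by rw [push_map_sw m x]

/-- Swapping inside a pairing: `⟨swap L, push m φ⟩ = ⟨L, push (m ∘ sw) φ⟩`. [folklore] -/
theorem pairLen_castK_swapL (W : ℕ) (L : BarFun) (m : Bool → F5 → K) (φ : NCSeries Bool K) :
    pairLen W (castK (K := K) (swapL L)) (push m φ) =
      pairLen W (castK (K := K) L) (push (fun b f => m b (sw f)) φ) := by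
  unfold pairLen
  have hinv : Function.Involutive (fun x : Fin W → F5 => sw ∘ x) := fun x =>
    funext fun i => sw_sw (x i)
  refine Fintype.sum_bijective _ hinv.bijective _ _ fun x => ?_
  simp only [castK_apply, swapL_apply, List.map_ofFn]
  congr 1
  rw [← push_map_sw, List.map_ofFn]
  congr 2
  funext i
  simp [Function.comp]

/-- `⟨l^{y,x}_{s,t}, push m_{ae} φ⟩ = π_Y(φ)(t s)`. [cite: Furusho2011, Lemma 5.2] -/
theorem pairLen_lyx_pushAE {s t : List ℕ} (hs : ∀ i ∈ s, 1 ≤ i) (ht : ∀ i ∈ t, 1 ≤ i)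
    (φ : NCSeries Bool K) :
    pairLen (s.sum + t.sum) (castK (lyx s t)) (push mAE φ) = piY φ (t ++ s) := by
  rw [lyx, pairLen_castK_swapL]
  have e : (fun b f => (mAE b (sw f) : K)) = mDE := funext fun b => funext fun f => mAE_sw b f
  rw [e, pairLen_lxy_pushDE' hs ht]

/-! ## B.5b.8 Furusho's `E₁` on the bar elements (Lemma 5.1) -/

section E1

variable (φ : NCSeries Bool K)

/-- The image `Ĝ₁ = φ(d,e) φ(a,b)` of Furusho's evaluation point `φ₄₅₁ φ₁₂₃` in the letters dual to
the five forms. [cite: Furusho2011, §5] -/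
def G₁ : NCSeries F5 K := push mDE φ * push mAB φ

/-- **Furusho's evaluation `E₁`** in weight `W`: `E₁(L) = ⟨L, Ĝ₁⟩_W`, as an additive map in `L`.
[cite: Furusho2011, §5, Lemma 5.1] -/
def E₁ (W : ℕ) : BarFun →+ K where
  toFun L := pairLen W (castK (K := K) L) (G₁ φ)
  map_zero' := by simp
  map_add' L L' := by simp [castK_add, pairLen_add_left]

/-- `E₁(L) = ⟨L, Ĝ₁⟩_W`. [folklore] -/
theorem E₁_apply (W : ℕ) (L : BarFun) : E₁ φ W L = pairLen W (castK (K := K) L) (G₁ φ) := rfl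

variable {φ}

/-- **`E₁` on functionals ending in `β₁`/`γ`**: only the factor `φ(d,e)` contributes,
`E₁(L) = ⟨L, φ(d,e)⟩ · c_∅(φ)` (words produced by `φ(a,b)` end in `α₀` or `α₁`). [folklore] -/
theorem E₁_of_endsBG {W : ℕ} {L : BarFun} (hL : EndsBG L) :
    E₁ φ W L = pairLen W (castK (K := K) L) (push mDE φ) * φ [] := by
  rw [E₁_apply, G₁, pairLen_mul]
  rw [Finset.sum_eq_single_of_mem (W, 0) (by simp) ?_]
  · dsimp only
    simp only [Finset.univ_unique, Finset.sum_singleton, List.ofFn_zero, List.append_nil, push_nil]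
    rw [pairLen, Finset.sum_mul]
    exact Finset.sum_congr rfl fun x _ => by ring
  · rintro ⟨n, j⟩ hp hne
    have hj : j ≠ 0 := by
      rintro rfl
      rw [Finset.HasAntidiagonal.mem_antidiagonal] at hp
      exact hne (by simp at hp; simp [hp])
    refine Finset.sum_eq_zero fun x _ => Finset.sum_eq_zero fun y _ => ?_
    obtain ⟨z', l, hz⟩ := exists_eq_append_singleton (z := List.ofFn y)
      (by rw [Ne, List.ofFn_eq_nil_iff]; exact hj)
    rw [hz]
    by_cases hl : l = a0 ∨ l = a1 ∨ l = b0
    · rw [castK_apply, ← List.append_assoc, hL _ l hl]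
      simp
    · have hnone : (preAB l : Option (Bool × K)) = none := by
        rcases l with _ | _ | _ | _ | _ <;> simp_all [preAB]
      rw [show push mAB φ (z' ++ [l]) = 0 from
        push_monoSubst_eq_zero_of_mem _ _ _ ⟨l, by simp, hnone⟩]
      ring

/-- **[Furusho2011, Lemma 5.1] `E₁(l^y_t) = π_Y(φ)(t)`** (`t` nonempty with positive entries,
`c_∅(φ) = 1`). [cite: Furusho2011, Lemma 5.1] -/
theorem E₁_ly (h0 : φ [] = 1) {t : List ℕ} (ht : ∀ i ∈ t, 1 ≤ i) (ht0 : t ≠ []) :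
    E₁ φ t.sum (ly t) = piY φ t := by
  rw [E₁_of_endsBG (endsBG_ly t ht ht0), h0, mul_one]
  have h := pairLen_lxy_pushDE' (K := K) (s := []) (t := t) (by simp) ht φ
  rwa [lxy_nil_left, List.sum_nil, zero_add, List.append_nil] at h

/-- **[Furusho2011, Lemma 5.1] `E₁(l^{xy}_u) = π_Y(φ)(u)`** (`u` nonempty with positive
entries). [cite: Furusho2011, Lemma 5.1] -/
theorem E₁_lxyD (h0 : φ [] = 1) {u : List ℕ} (hu : ∀ i ∈ u, 1 ≤ i) (hu0 : u ≠ []) :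
    E₁ φ u.sum (lxyD u) = piY φ u := by
  rw [E₁_of_endsBG (endsBG_lxyD u hu hu0), h0, mul_one]
  have h := pairLen_lxy_pushDE' (K := K) (s := u) (t := []) hu (by simp) φ
  rwa [lxy_nil_right', List.sum_nil, add_zero, List.nil_append] at h

/-- **[Furusho2011, Lemma 5.1] `E₁(l^{x,y}_{v,q}) = π_Y(φ)(q v)`** (positive entries, not both
empty). [cite: Furusho2011, Lemma 5.1] -/
theorem E₁_lxy (h0 : φ [] = 1) {v q : List ℕ} (hv : ∀ i ∈ v, 1 ≤ i) (hq : ∀ i ∈ q, 1 ≤ i)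
    (h : v ≠ [] ∨ q ≠ []) : E₁ φ (v.sum + q.sum) (lxy v q) = piY φ (q ++ v) := by
  rw [E₁_of_endsBG (endsBG_lxy _ v q hv hq h le_rfl), h0, mul_one, pairLen_lxy_pushDE' hv hq]

/-- **[Furusho2011, Lemma 5.1] `E₁(l^x_s) = π_Y(φ)(s)`**: the factor `φ(d, e)` produces words in
`α₁, β₀, β₁, γ` only, which meet the support `{α₀, α₁}*` of `l^x` in the pure powers `α₁ᵏ`, where
`c_{X₁ᵏ}(φ) = 0`. [cite: Furusho2011, Lemma 5.1] -/
theorem E₁_lx (h0 : φ [] = 1) (h1 : ∀ k, 1 ≤ k → φ (List.replicate k true) = 0) {s : List ℕ}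
    (hs : ∀ i ∈ s, 1 ≤ i) : E₁ φ s.sum (lx s) = piY φ s := by
  rw [E₁_apply, G₁, pairLen_mul]
  rw [Finset.sum_eq_single_of_mem (0, s.sum) (by simp) ?_]
  · dsimp only
    simp only [Finset.univ_unique, Finset.sum_singleton, List.ofFn_zero, List.nil_append, push_nil, h0,
      one_mul]
    exact pairLen_lx_pushAB s hs φ
  · rintro ⟨n, j⟩ hp hne
    have hn : n ≠ 0 := by
      rintro rfl
      rw [Finset.HasAntidiagonal.mem_antidiagonal] at hp
      exact hne (by simp at hp; simp [hp])
    refine Finset.sum_eq_zero fun x _ => Finset.sum_eq_zero fun y _ => ?_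
    by_cases hx : ∃ f ∈ List.ofFn x, f ≠ a1
    · obtain ⟨f, hf, hfa⟩ := hx
      by_cases hf0 : f = a0
      · subst hf0
        rw [show push mDE φ (List.ofFn x) = 0 from
          push_monoSubst_eq_zero_of_mem _ _ _ ⟨a0, hf, rfl⟩]
        ring
      · rw [castK_apply, lx_apply_eq_zero_of_mem _ s ⟨f, List.mem_append_left _ hf, hf0, hfa⟩]
        simp
    · push Not at hx
      rw [eq_replicate_of_forall hx, List.length_ofFn,
        push_monoSubst_replicate (preDE (K := K)) φ (f := a1) rfl n, h1 n (Nat.one_le_iff_ne_zero.mpr hn)]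
      ring

end E1

/-! ## B.5b.9 The representation of `U𝔞₄/(deg > N)` on integrable functionals -/

section Rep

variable (K)

/-- The space `V_N`: `K`-valued functionals on words in the five letters which kill the six
quadratic relations of `U𝔓₅` at every position (integrability, `BarFun.Integrable`) and vanish in
length `> N`. [cite: Furusho2011, §3] -/
def VN (N : ℕ) : Submodule K (List F5 → K) where
  carrier := {ψ | (∀ (u w : List F5) (i : Fin 6),
      ∑ p : F5, ∑ q : F5, (rel i p q : K) * ψ (u ++ p :: q :: w) = 0) ∧
    ∀ w : List F5, N < w.length → ψ w = 0}
  add_mem' := by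
    rintro ψ χ ⟨h1, h2⟩ ⟨h1', h2'⟩
    refine ⟨fun u w i => ?_, fun w hw => by simp [h2 w hw, h2' w hw]⟩
    simp only [Pi.add_apply, mul_add, Finset.sum_add_distrib, h1 u w i, h1' u w i, add_zero]
  zero_mem' := ⟨fun u w i => by simp, fun w _ => rfl⟩
  smul_mem' := by
    rintro c ψ ⟨h1, h2⟩
    refine ⟨fun u w i => ?_, fun w hw => by simp [h2 w hw]⟩
    rw [show (∑ p : F5, ∑ q : F5, (rel i p q : K) * (c • ψ) (u ++ p :: q :: w)) =
        c * ∑ p : F5, ∑ q : F5, (rel i p q : K) * ψ (u ++ p :: q :: w) by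
      rw [Finset.mul_sum]
      refine Finset.sum_congr rfl fun p _ => ?_
      rw [Finset.mul_sum]
      refine Finset.sum_congr rfl fun q _ => ?_
      rw [Pi.smul_apply, smul_eq_mul]; ring, h1 u w i, mul_zero]

variable {K}

/-- **Integrable bar functionals of weight `W ≤ N` are elements of `V_N`.** [folklore] -/
def mkV {N W : ℕ} (L : BarFun) (hI : Integrable L) (hW : Homog W L) (hWN : W ≤ N) : VN K N :=
  ⟨castK L, fun u w i => by
    have h1 : (∑ p : F5, ∑ q : F5, rel i p q • der q (der p (shift u L))) w = (0 : BarFun) w :=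
      congrFun (hI u i) w
    have e : ∀ p q : F5, (rel i p q • der q (der p (shift u L))) w = rel i p q * L (u ++ p :: q :: w) :=
      fun p q => rfl
    simp only [Finset.sum_apply, e, Pi.zero_apply] at h1
    have h2 := congrArg (Int.cast : ℤ → K) h1
    push_cast at h2
    simpa using h2,
   fun w hw => by rw [castK_apply, hW w (by omega), Int.cast_zero]⟩

/-- The underlying functional of `mkV L`. [folklore] -/
@[simp] theorem mkV_val {N W : ℕ} (L : BarFun) (hI : Integrable L) (hW : Homog W L) (hWN : W ≤ N) :
    (mkV (K := K) L hI hW hWN).1 = castK L := rfl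

variable (K)

/-- Right-appending a letter, `(R_f ψ)(w) = ψ(w f)`, preserves `V_N`. [folklore] -/
def appR (N : ℕ) (f : F5) : VN K N →ₗ[K] VN K N where
  toFun ψ := ⟨fun w => ψ.1 (w ++ [f]),
    fun u w i => by simpa [List.append_assoc] using ψ.2.1 u (w ++ [f]) i,
    fun w hw => ψ.2.2 _ (by simp; omega)⟩
  map_add' _ _ := rfl
  map_smul' _ _ := rfl

/-- `(R_f ψ)(w) = ψ(w f)`. [folklore] -/
@[simp] theorem appR_apply_val (N : ℕ) (f : F5) (ψ : VN K N) (w : List F5) :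
    (appR K N f ψ).1 w = ψ.1 (w ++ [f]) := rfl

/-- The operator `D_m = Σ_f m(f) R_f` of a coefficient vector `m`. [folklore] -/
def DK (N : ℕ) (m : F5 → K) : Module.End K (VN K N) := ∑ f : F5, m f • appR K N f

/-- `(D_m ψ)(w) = Σ_f m(f) ψ(w f)`. [folklore] -/
theorem DK_apply_val (N : ℕ) (m : F5 → K) (ψ : VN K N) (w : List F5) :
    (DK K N m ψ).1 w = ∑ f : F5, m f * ψ.1 (w ++ [f]) := by
  simp only [DK, LinearMap.sum_apply, LinearMap.smul_apply, Submodule.coe_sum, Submodule.coe_smul,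
    Finset.sum_apply, Pi.smul_apply, smul_eq_mul, appR_apply_val]

/-- `D_m + D_{m'} = D_{m+m'}`. [folklore] -/
theorem DK_add (N : ℕ) (m m' : F5 → K) : DK K N m + DK K N m' = DK K N (m + m') := by
  simp only [DK, Pi.add_apply, add_smul, Finset.sum_add_distrib]

/-- **`D_μ` and `D_ν` commute on functionals killing `μ ∧ ν`**:
`(D_μ D_ν - D_ν D_μ) ψ (w) = Σ_{p,q} (μ(p)ν(q) - ν(p)μ(q)) ψ(w p q)`. [folklore] -/
theorem DK_comm_apply (N : ℕ) {μ ν : F5 → K} {ψ : VN K N}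
    (h : ∀ u : List F5, ∑ p : F5, ∑ q : F5, (μ p * ν q - ν p * μ q) * ψ.1 (u ++ [p, q]) = 0) :
    DK K N μ (DK K N ν ψ) = DK K N ν (DK K N μ ψ) := by
  apply Subtype.ext
  funext u
  have h' : ∑ p : F5, ∑ q : F5, μ p * ν q * ψ.1 (u ++ [p, q]) =
      ∑ p : F5, ∑ q : F5, ν p * μ q * ψ.1 (u ++ [p, q]) := by
    rw [← sub_eq_zero, ← Finset.sum_sub_distrib, ← h u]
    refine Finset.sum_congr rfl fun p _ => ?_
    rw [← Finset.sum_sub_distrib]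
    refine Finset.sum_congr rfl fun q _ => ?_
    ring
  simp only [DK_apply_val, Finset.mul_sum, List.append_assoc, List.singleton_append, ← mul_assoc]
  exact h'

/-- The coefficient vector `δ_p`. [folklore] -/
def dlt (p : F5) : F5 → ℤ := fun f => if f = p then 1 else 0

/-- **The pairing table `⟨form, t_ij⟩`** of the identification `U𝔞₄ ≅ U𝔓₅` in the basis of
`U𝔓₅` dual to the forms `α₀, α₁, β₀, β₁, γ`: `t₁₂ ↦ δ_{α₀}`, `t₂₃ ↦ -δ_{α₁}`, `t₃₄ ↦ -δ_{β₁}`,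
`t₂₄ ↦ -δ_γ`, `t₁₃ ↦ δ_{β₀} - δ_{α₀} + δ_{α₁}`, `t₁₄ ↦ -δ_{β₀} + δ_{β₁} + δ_γ` (strands `0..3`; the
centre `Σ t_ij` maps to `0`). [cite: Furusho2011, §2, §5] -/
def Mtab : Fin 4 → Fin 4 → F5 → ℤ
  | 0, 1 => dlt a0
  | 1, 0 => dlt a0
  | 1, 2 => -dlt a1
  | 2, 1 => -dlt a1
  | 2, 3 => -dlt b1
  | 3, 2 => -dlt b1
  | 1, 3 => -dlt g
  | 3, 1 => -dlt g
  | 0, 2 => dlt b0 - dlt a0 + dlt a1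
  | 2, 0 => dlt b0 - dlt a0 + dlt a1
  | 0, 3 => -dlt b0 + dlt b1 + dlt g
  | 3, 0 => -dlt b0 + dlt b1 + dlt g
  | _, _ => 0

/-- The exterior product `(μ ∧ ν)(p, q) = μ(p)ν(q) - ν(p)μ(q)` of coefficient vectors. [folklore] -/
def wedgeZ (μ ν : F5 → ℤ) : F5 → F5 → ℤ := fun p q => μ p * ν q - ν p * μ q

/-- **Decomposition lemma**: an antisymmetric `τ` on pairs of letters with `τ(α₀,α₁) = 0`,
`τ(β₀,β₁) = 0`, `τ(α₀,γ) + τ(β₀,γ) = 0`, `τ(α₁,γ) - τ(β₁,γ) - τ(α₁,β₁) + τ(α₀,γ) = 0` is the explicit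
combination `τ(α₀β₁)ρ₀ + τ(α₀β₀)ρ₁ + τ(α₁β₀)ρ₂ + τ(α₁γ)ρ₃ + τ(β₁γ)ρ₄ + τ(α₀γ)ρ₅` of the six
relations `BarFun.rel`. [folklore] -/
theorem rel_decomp (τ : F5 → F5 → ℤ) (hanti : ∀ p q, τ p q = -τ q p) (C1 : τ a0 a1 = 0)
    (C2 : τ b0 b1 = 0) (C3 : τ a0 g + τ b0 g = 0) (C4 : τ a1 g - τ b1 g - τ a1 b1 + τ a0 g = 0) :
    τ = τ a0 b1 • rel 0 + τ a0 b0 • rel 1 + τ a1 b0 • rel 2 + τ a1 g • rel 3 + τ b1 g • rel 4 +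
      τ a0 g • rel 5 := by
  funext p q
  have := hanti p q
  cases p <;> cases q <;> simp [rel, comm] <;>
    linarith [hanti a0 a1, hanti a0 b0, hanti a0 b1, hanti a0 g, hanti a1 b0, hanti a1 b1,
      hanti a1 g, hanti b0 b1, hanti b0 g, hanti b1 g, hanti a0 a0, hanti a1 a1, hanti b0 b0,
      hanti b1 b1, hanti g g]

/-- Functionals in `V_N` kill every such `τ` at every position. [folklore] -/
theorem kills_of_conds {N : ℕ} (ψ : VN K N) (τ : F5 → F5 → ℤ) (hanti : ∀ p q, τ p q = -τ q p)
    (C1 : τ a0 a1 = 0) (C2 : τ b0 b1 = 0) (C3 : τ a0 g + τ b0 g = 0)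
    (C4 : τ a1 g - τ b1 g - τ a1 b1 + τ a0 g = 0) (u w : List F5) :
    ∑ p : F5, ∑ q : F5, (τ p q : K) * ψ.1 (u ++ p :: q :: w) = 0 := by
  have hI := ψ.2.1 u w
  rw [rel_decomp τ hanti C1 C2 C3 C4]
  simp only [Pi.add_apply, Pi.smul_apply, smul_eq_mul, Int.cast_add, Int.cast_mul, add_mul,
    Finset.sum_add_distrib, mul_assoc, ← Finset.mul_sum, hI, mul_zero, add_zero]

/-- `μ ∧ ν` is antisymmetric. [folklore] -/
theorem wedgeZ_anti (μ ν : F5 → ℤ) (p q : F5) : wedgeZ μ ν p q = -wedgeZ μ ν q p := by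
  simp only [wedgeZ]; ring

/-- The four-term tensors `M_ij ∧ (M_ik + M_jk)` satisfy the four linear conditions of
`rel_decomp` (a finite check). [folklore] -/
theorem Mtab_fourTerm_conds : ∀ i j k : Fin 4, i ≠ j → j ≠ k → i ≠ k →
    wedgeZ (Mtab i j) (Mtab i k + Mtab j k) a0 a1 = 0 ∧
      wedgeZ (Mtab i j) (Mtab i k + Mtab j k) b0 b1 = 0 ∧
      wedgeZ (Mtab i j) (Mtab i k + Mtab j k) a0 g + wedgeZ (Mtab i j) (Mtab i k + Mtab j k) b0 g = 0 ∧
      wedgeZ (Mtab i j) (Mtab i k + Mtab j k) a1 g - wedgeZ (Mtab i j) (Mtab i k + Mtab j k) b1 g -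
        wedgeZ (Mtab i j) (Mtab i k + Mtab j k) a1 b1 +
        wedgeZ (Mtab i j) (Mtab i k + Mtab j k) a0 g = 0 := by
  decide

/-- The locality tensors `M_ij ∧ M_kl` satisfy the four linear conditions of `rel_decomp`
(a finite check). [folklore] -/
theorem Mtab_locality_conds : ∀ i j k l : Fin 4, i ≠ j → i ≠ k → i ≠ l → j ≠ k → j ≠ l → k ≠ l →
    wedgeZ (Mtab i j) (Mtab k l) a0 a1 = 0 ∧
      wedgeZ (Mtab i j) (Mtab k l) b0 b1 = 0 ∧
      wedgeZ (Mtab i j) (Mtab k l) a0 g + wedgeZ (Mtab i j) (Mtab k l) b0 g = 0 ∧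
      wedgeZ (Mtab i j) (Mtab k l) a1 g - wedgeZ (Mtab i j) (Mtab k l) b1 g -
        wedgeZ (Mtab i j) (Mtab k l) a1 b1 + wedgeZ (Mtab i j) (Mtab k l) a0 g = 0 := by
  decide

/-- The images `D_{ij} = Σ_f ⟨f, t_ij⟩ R_f` of the generators. [folklore] -/
def Dt (N : ℕ) (i j : Fin 4) : Module.End K (VN K N) := DK K N fun f => (Mtab i j f : K)

variable {K}

/-- Commutation of `D_μ, D_ν` for integer vectors whose wedge satisfies the conditions. [folklore] -/
theorem DK_comm_of_conds (N : ℕ) (μ ν : F5 → ℤ) (C1 : wedgeZ μ ν a0 a1 = 0)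
    (C2 : wedgeZ μ ν b0 b1 = 0) (C3 : wedgeZ μ ν a0 g + wedgeZ μ ν b0 g = 0)
    (C4 : wedgeZ μ ν a1 g - wedgeZ μ ν b1 g - wedgeZ μ ν a1 b1 + wedgeZ μ ν a0 g = 0) :
    DK K N (fun f => (μ f : K)) * DK K N (fun f => (ν f : K)) =
      DK K N (fun f => (ν f : K)) * DK K N (fun f => (μ f : K)) := by
  refine LinearMap.ext fun ψ => ?_
  rw [Module.End.mul_apply, Module.End.mul_apply]
  refine DK_comm_apply K N fun u => ?_
  have h := kills_of_conds K ψ (wedgeZ μ ν) (wedgeZ_anti μ ν) C1 C2 C3 C4 u []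
  simp only [wedgeZ, Int.cast_sub, Int.cast_mul] at h
  exact h

/-- Products of `|l|` operators `D_m` shift the argument by `|l|` letters. [folklore] -/
theorem list_prod_DK_apply_val (N : ℕ) (ψ : VN K N) : ∀ (l : List (F5 → K)) (w : List F5),
    (∀ x : List F5, x.length = l.length → ψ.1 (w ++ x) = 0) → ((l.map (DK K N)).prod ψ).1 w = 0
  | [], w, h => by simpa using h [] rfl
  | m :: l, w, h => by
    rw [List.map_cons, List.prod_cons, Module.End.mul_apply, DK_apply_val]
    refine Finset.sum_eq_zero fun f _ => ?_
    rw [list_prod_DK_apply_val N ψ l (w ++ [f]) fun x hx => ?_, mul_zero]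
    rw [List.append_assoc, List.singleton_append]
    exact h (f :: x) (by simp [hx])

variable (K)

/-- **The family `D_{ij}` is compatible with the truncated Drinfeld–Kohno relations**: the
infinitesimal braid relations hold on `V_N` because integrable functionals kill the six relations
of `U𝔓₅`, and `(N+1)`-fold products vanish by the length truncation. [cite: Furusho2011, §3, §5] -/
theorem Mtab_compatible (N : ℕ) : DrinfeldKohnoTrunc.Compatible N (Dt K N) where
  diag i := by
    have h : ∀ f, Mtab i i f = 0 := by intro f; fin_cases i <;> rfl
    simp only [Dt, h, Int.cast_zero, DK, zero_smul, Finset.sum_const_zero]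
  symm i j := by
    have h : Mtab i j = Mtab j i := by fin_cases i <;> fin_cases j <;> rfl
    simp only [Dt, h]
  fourTerm i j k hij hjk hik := by
    obtain ⟨C1, C2, C3, C4⟩ := Mtab_fourTerm_conds i j k hij hjk hik
    have e : Dt K N i k + Dt K N j k = DK K N (fun f => ((Mtab i k + Mtab j k) f : K)) := by
      rw [Dt, Dt, DK_add]; congr 1; funext f; simp
    rw [e, Dt]
    exact DK_comm_of_conds N _ _ C1 C2 C3 C4
  locality i j k l h1 h2 h3 h4 h5 h6 := by
    obtain ⟨C1, C2, C3, C4⟩ := Mtab_locality_conds i j k l h1 h2 h3 h4 h5 h6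
    exact DK_comm_of_conds N _ _ C1 C2 C3 C4
  trunc g := by
    rw [show (List.ofFn fun r => Dt K N (g r).1 (g r).2) =
        (List.ofFn fun r => fun f => (Mtab (g r).1 (g r).2 f : K)).map (DK K N) by
      rw [List.map_ofFn]; rfl]
    refine LinearMap.ext fun ψ => Subtype.ext (funext fun w => ?_)
    rw [LinearMap.zero_apply]
    exact list_prod_DK_apply_val N ψ _ w fun x hx => ψ.2.2 _ (by
      rw [List.length_ofFn] at hx; simp only [List.length_append, hx]; omega)

/-- **The representation `ρ_N : U𝔞₄/(deg > N) → End(V_N)`**, `t_ij ↦ D_{ij}`. [cite: Furusho2011, §5] -/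
def ρN (N : ℕ) : DrinfeldKohnoTrunc K (Fin 4) N →ₐ[K] Module.End K (VN K N) :=
  (Mtab_compatible K N).lift

/-- `ρ_N(t_ij) = D_{ij}`. [folklore] -/
@[simp] theorem ρN_t₄ (N : ℕ) (i j : Fin 4) : ρN K N (t₄ K N i j) = Dt K N i j :=
  (Mtab_compatible K N).lift_t i j

/-- `ρ_N(φ(a, b)) = φ(ρ_N a, ρ_N b)`. [folklore] -/
theorem ρN_subst₂ (N : ℕ) (φ : NCSeries Bool K) (a b : DrinfeldKohnoTrunc K (Fin 4) N) :
    ρN K N (subst₂ N φ a b) = subst₂ N φ (ρN K N a) (ρN K N b) := by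
  rw [subst₂, subst₂, evalTrunc, evalTrunc, map_sum]
  refine Finset.sum_congr rfl fun n _ => ?_
  rw [map_sum]
  refine Finset.sum_congr rfl fun w _ => ?_
  rw [map_smul, map_list_prod, List.map_map, NCSeries.comp_bsub]

/-! ### The five coefficient vectors `a, b, c, d, e` -/

/-- `⟨·, a⟩ = ⟨·, t₁₂⟩ = δ_{α₀}`. [folklore] -/
def cA : F5 → K | a0 => 1 | _ => 0
/-- `⟨·, b⟩ = ⟨·, t₂₃⟩ = -δ_{α₁}`. [folklore] -/
def cB : F5 → K | a1 => -1 | _ => 0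
/-- `⟨·, c⟩ = ⟨·, t₃₄⟩ = -δ_{β₁}`. [folklore] -/
def cC : F5 → K | b1 => -1 | _ => 0
/-- `⟨·, d⟩ = ⟨·, t₁₂+t₁₃+t₂₃⟩ = δ_{β₀}`. [folklore] -/
def cD : F5 → K | b0 => 1 | _ => 0
/-- `⟨·, e⟩ = ⟨·, t₂₃+t₂₄+t₃₄⟩ = -δ_{α₁} - δ_{β₁} - δ_γ`. [folklore] -/
def cE : F5 → K | a1 => -1 | b1 => -1 | g => -1 | _ => 0

/-- `D_{01} = D_a`. [folklore] -/
theorem Dt01 (N : ℕ) : Dt K N 0 1 = DK K N (cA K) := by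
  rw [Dt]; congr 1; funext f; cases f <;> simp [Mtab, dlt, cA]
/-- `D_{12} = D_b`. [folklore] -/
theorem Dt12 (N : ℕ) : Dt K N 1 2 = DK K N (cB K) := by
  rw [Dt]; congr 1; funext f; cases f <;> simp [Mtab, dlt, cB]
/-- `D_{23} = D_c`. [folklore] -/
theorem Dt23 (N : ℕ) : Dt K N 2 3 = DK K N (cC K) := by
  rw [Dt]; congr 1; funext f; cases f <;> simp [Mtab, dlt, cC]
/-- `D_{01} + D_{02} + D_{12} = D_d`. [folklore] -/
theorem Dt_d (N : ℕ) : Dt K N 0 1 + Dt K N 0 2 + Dt K N 1 2 = DK K N (cD K) := by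
  rw [Dt, Dt, Dt, DK_add, DK_add]; congr 1; funext f; cases f <;> simp [Mtab, dlt, cD]
/-- `D_{12} + D_{13} + D_{23} = D_e`. [folklore] -/
theorem Dt_e (N : ℕ) : Dt K N 1 2 + Dt K N 1 3 + Dt K N 2 3 = DK K N (cE K) := by
  rw [Dt, Dt, Dt, DK_add, DK_add]; congr 1; funext f; cases f <;> simp [Mtab, dlt, cE]

/-- `m_{de} = (d, e)`. [folklore] -/
theorem bsub_cD_cE : bsub (cD K) (cE K) = mDE := by
  funext b f; cases b <;> cases f <;> simp [bsub, cD, cE, mDE, monoSubst, preDE]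
/-- `m_{ab} = (a, b)`. [folklore] -/
theorem bsub_cA_cB : bsub (cA K) (cB K) = mAB := by
  funext b f; cases b <;> cases f <;> simp [bsub, cA, cB, mAB, monoSubst, preAB]
/-- `m_{cb} = (c, b)`. [folklore] -/
theorem bsub_cC_cB : bsub (cC K) (cB K) = mCB := by
  funext b f; cases b <;> cases f <;> simp [bsub, cC, cB, mCB, monoSubst, preCB]
/-- `m_{ae} = (a, e)`. [folklore] -/
theorem bsub_cA_cE : bsub (cA K) (cE K) = mAE := by
  funext b f; cases b <;> cases f <;> simp [bsub, cA, cE, mAE, monoSubst, preAE]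
/-- `m_{dc} = (d, c)`. [folklore] -/
theorem bsub_cD_cC : bsub (cD K) (cC K) = mDC := by
  funext b f; cases b <;> cases f <;> simp [bsub, cD, cC, mDC, monoSubst, preDC]

variable {K}

/-! ### The bridge: `ρ_N(φ(u, v))` as pairings with pushforwards -/

/-- `c_x(push m φ) = Σ_{|w| = |x|} c_w(φ) ∏ᵢ m(wᵢ, xᵢ)`. [folklore] -/
theorem push_eq_sum_prod {α β : Type*} [Fintype β] (m : β → α → K) :
    ∀ (n : ℕ) (φ : NCSeries β K) (x : Fin n → α),
    push m φ (List.ofFn x) = ∑ w : Fin n → β, φ (List.ofFn w) * ∏ i, m (w i) (x i)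
  | 0, φ, x => by simp
  | n + 1, φ, x => by
    rw [List.ofFn_succ, push_cons, sum_fin_succ_fun]
    refine Finset.sum_congr rfl fun b _ => ?_
    rw [push_eq_sum_prod m n (lderiv b φ) (fun i => x i.succ), Finset.mul_sum]
    refine Finset.sum_congr rfl fun w _ => ?_
    rw [Fin.prod_univ_succ, lderiv_apply, List.ofFn_succ]
    simp only [Fin.cons_zero, Fin.cons_succ]
    ring

/-- A product of operators `D` along a binary word, applied and evaluated:
`(D_{w₁} ⋯ D_{w_n} ψ)(u) = Σ_{|x| = n} (∏ m(wᵢ, xᵢ)) ψ(u x)`. [folklore] -/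
theorem prod_map_DK_apply_val {N : ℕ} (m : Bool → F5 → K) (ψ : VN K N) :
    ∀ (n : ℕ) (w : Fin n → Bool) (u : List F5),
    (((List.ofFn w).map fun b => DK K N (m b)).prod ψ).1 u =
      ∑ x : Fin n → F5, (∏ i, m (w i) (x i)) * ψ.1 (u ++ List.ofFn x)
  | 0, w, u => by simp
  | n + 1, w, u => by
    rw [List.ofFn_succ, List.map_cons, List.prod_cons, Module.End.mul_apply, DK_apply_val,
      sum_fin_succ_fun]
    refine Finset.sum_congr rfl fun f _ => ?_
    rw [prod_map_DK_apply_val m ψ n (fun i => w i.succ) (u ++ [f]), Finset.mul_sum]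
    refine Finset.sum_congr rfl fun x _ => ?_
    rw [Fin.prod_univ_succ, List.ofFn_succ]
    simp only [Fin.cons_zero, Fin.cons_succ, List.append_assoc, List.singleton_append]
    ring

/-- **Bridge, one factor**: `(ρ(φ(D_{A₀}, D_{A₁})) ψ)(u) = Σ_{n ≤ N} ⟨ψ(u ·), push (A₀,A₁) φ⟩_n`.
[folklore] -/
theorem subst₂_DK_apply_val {N : ℕ} (A₀ A₁ : F5 → K) (φ : NCSeries Bool K) (ψ : VN K N)
    (u : List F5) :
    ((subst₂ N φ (DK K N A₀) (DK K N A₁)) ψ).1 u =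
      ∑ n ∈ Finset.range (N + 1), pairLen n (fun x => ψ.1 (u ++ x)) (push (bsub A₀ A₁) φ) := by
  have e : bsub (DK K N A₀) (DK K N A₁) = fun b => DK K N (bsub A₀ A₁ b) :=
    funext fun b => by cases b <;> rfl
  rw [subst₂, evalTrunc, e]
  simp only [LinearMap.sum_apply, LinearMap.smul_apply, Submodule.coe_sum, Submodule.coe_smul,
    Finset.sum_apply, Pi.smul_apply, smul_eq_mul, prod_map_DK_apply_val]
  refine Finset.sum_congr rfl fun n _ => ?_
  rw [pairLen]
  simp only [Finset.mul_sum]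
  rw [Finset.sum_comm]
  refine Finset.sum_congr rfl fun x _ => ?_
  rw [push_eq_sum_prod, Finset.mul_sum]
  exact Finset.sum_congr rfl fun w _ => by ring

/-- **Bridge, two factors** at the empty word:
`(ρ(φ(A) φ(B)) ψ)(∅) = Σ_{n, j ≤ N} Σ_{|x|=n,|y|=j} ψ(x y) c_y(push B φ) c_x(push A φ)`. [folklore] -/
theorem subst₂_mul_subst₂_apply_val {N : ℕ} (A₀ A₁ B₀ B₁ : F5 → K) (φ : NCSeries Bool K)
    (ψ : VN K N) :
    ((subst₂ N φ (DK K N A₀) (DK K N A₁) * subst₂ N φ (DK K N B₀) (DK K N B₁)) ψ).1 [] =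
      ∑ n ∈ Finset.range (N + 1), ∑ j ∈ Finset.range (N + 1), ∑ x : Fin n → F5, ∑ y : Fin j → F5,
        ψ.1 (List.ofFn x ++ List.ofFn y) * push (bsub B₀ B₁) φ (List.ofFn y) *
          push (bsub A₀ A₁) φ (List.ofFn x) := by
  rw [Module.End.mul_apply, subst₂_DK_apply_val]
  refine Finset.sum_congr rfl fun n _ => ?_
  simp only [pairLen, List.nil_append, subst₂_DK_apply_val, Finset.sum_mul]
  rw [Finset.sum_comm]

/-- Double range sums of a function supported on `n + j = W ≤ N` are antidiagonal sums. [folklore] -/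
theorem sum_range_range_eq_antidiagonal {M : Type*} [AddCommMonoid M] {W N : ℕ} (hWN : W ≤ N)
    (F : ℕ → ℕ → M) (hF : ∀ n j, n + j ≠ W → F n j = 0) :
    ∑ n ∈ Finset.range (N + 1), ∑ j ∈ Finset.range (N + 1), F n j =
      ∑ p ∈ Finset.HasAntidiagonal.antidiagonal W, F p.1 p.2 := by
  rw [← Finset.sum_product']
  symm
  refine Finset.sum_subset (fun p hp => ?_) fun p _ hp => ?_
  · rw [Finset.HasAntidiagonal.mem_antidiagonal] at hp
    simp only [Finset.mem_product, Finset.mem_range]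
    omega
  · rw [Finset.HasAntidiagonal.mem_antidiagonal] at hp
    exact hF _ _ hp

/-- **`E₁` is the matrix coefficient `(ρ_N(φ(d,e) φ(a,b)) L)(∅)`** for homogeneous `L` of weight
`W ≤ N`. [cite: Furusho2011, §5] -/
theorem E₁_eq_op {φ : NCSeries Bool K} {N W : ℕ} (hWN : W ≤ N) {L : BarFun} (hL : Homog W L)
    (ψ : VN K N) (hψ : ψ.1 = castK L) :
    E₁ φ W L = ((subst₂ N φ (DK K N (cD K)) (DK K N (cE K)) *
      subst₂ N φ (DK K N (cA K)) (DK K N (cB K))) ψ).1 [] := by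
  rw [subst₂_mul_subst₂_apply_val, bsub_cD_cE, bsub_cA_cB, E₁_apply, G₁, pairLen_mul, hψ,
    sum_range_range_eq_antidiagonal hWN]
  · exact Finset.sum_congr rfl fun p _ => Finset.sum_congr rfl fun x _ =>
      Finset.sum_congr rfl fun y _ => by ring
  · intro n j hnj
    refine Finset.sum_eq_zero fun x _ => Finset.sum_eq_zero fun y _ => ?_
    rw [castK_apply, hL _ (by simpa using hnj), Int.cast_zero, zero_mul, zero_mul]

/-! ## B.5b.10 Lemma 5.2: the value of `E₂` on `l^{y,x}` -/

/-- The factor `φ(d, c)` acts as the scalar `c_∅(φ)` on `l^{y,x}_{v,p}` (`p ≠ ∅`): its words lie in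
`{β₀, β₁}*`, i.e. end in `α₀, α₁` after the swap. [cite: Furusho2011, Lemma 5.2] -/
theorem substDC_apply {φ : NCSeries Bool K} {N : ℕ} {v p : List ℕ} (hv : ∀ i ∈ v, 1 ≤ i)
    (hp : ∀ i ∈ p, 1 ≤ i) (hp0 : p ≠ []) (ψ : VN K N) (hψ : ψ.1 = castK (lyx v p)) :
    subst₂ N φ (DK K N (cD K)) (DK K N (cC K)) ψ = φ [] • ψ := by
  have hE : EndsBG (lxy v p) := endsBG_lxy _ v p hv hp (Or.inr hp0) le_rfl
  apply Subtype.ext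
  funext w
  rw [subst₂_DK_apply_val, bsub_cD_cC, Submodule.coe_smul, Pi.smul_apply, smul_eq_mul,
    Finset.sum_eq_single_of_mem 0 (by simp) ?_]
  · simp [mul_comm]
  · intro l _ hl0
    refine Finset.sum_eq_zero fun z _ => ?_
    obtain ⟨z', f, hz⟩ := exists_eq_append_singleton (z := List.ofFn z)
      (by rw [Ne, List.ofFn_eq_nil_iff]; exact hl0)
    rw [hz]
    dsimp only
    by_cases hf : f = b0 ∨ f = b1
    · rw [hψ, castK_apply]
      simp only [lyx, swapL_apply, List.map_append, List.map_cons, List.map_nil]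
      rw [← List.append_assoc, hE _ (sw f) (by rcases hf with rfl | rfl <;> simp [sw])]
      simp
    · have hnone : (preDC f : Option (Bool × K)) = none := by
        rcases f with _ | _ | _ | _ | _ <;> simp_all [preDC]
      rw [show push mDC φ (z' ++ [f]) = 0 from
        push_monoSubst_eq_zero_of_mem _ _ _ ⟨f, by simp, hnone⟩, mul_zero]

/-- **[Furusho2011, Lemma 5.2] `E₂(l^{y,x}_{v,p}) = π_Y(φ)(p v)` for `p` with head `≥ 2`**, as the
matrix coefficient `(ρ_N(φ(c,b) φ(a,e) φ(d,c)) l^{y,x})(∅)`: `φ(d,c)` acts as `1`; the words of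
`φ(c,b)` lie in `{α₁,β₁}*` and pair to zero by the prefix property unless they are pure powers
`β₁ⁿ`, where `c_{X₀ⁿ}(φ) = 0`; what remains is `⟨l^{y,x}, φ(a,e)⟩ = ⟨l^{x,y}, φ(d,e)⟩`.
[cite: Furusho2011, Lemma 5.2] -/
theorem op₂_lyx {φ : NCSeries Bool K} (h0 : φ [] = 1)
    (h0' : ∀ k, 1 ≤ k → φ (List.replicate k false) = 0) {N : ℕ} {v p : List ℕ}
    (hv : ∀ i ∈ v, 1 ≤ i) (hp : ∀ i ∈ p, 1 ≤ i) (hp0 : p ≠ []) (hph : ∀ h : p ≠ [], 2 ≤ p.head h)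
    (hWN : v.sum + p.sum ≤ N) (ψ : VN K N) (hψ : ψ.1 = castK (lyx v p)) :
    ((subst₂ N φ (DK K N (cC K)) (DK K N (cB K)) * subst₂ N φ (DK K N (cA K)) (DK K N (cE K)) *
      subst₂ N φ (DK K N (cD K)) (DK K N (cC K))) ψ).1 [] = piY φ (p ++ v) := by
  rw [Module.End.mul_apply, substDC_apply hv hp hp0 ψ hψ, h0, one_smul, Module.End.mul_apply,
    subst₂_DK_apply_val, bsub_cC_cB, Finset.sum_eq_single_of_mem 0 (by simp) ?_]
  · rw [pairLen_zero, push_nil, h0, mul_one, List.append_nil, subst₂_DK_apply_val, bsub_cA_cE]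
    simp only [List.nil_append]
    have hH : Homog (v.sum + p.sum) (fun x => ψ.1 x) := by
      rw [show (fun x => ψ.1 x) = castK (lyx v p) from hψ]
      exact homog_castK (homog_lxy' hv hp).2
    rw [Finset.sum_eq_single_of_mem (v.sum + p.sum) (by simp; omega) fun j _ hj =>
      pairLen_eq_zero_of_homog hH hj _]
    rw [show (fun x => ψ.1 x) = castK (lyx v p) from hψ]
    exact pairLen_lyx_pushAE hv hp φ
  · intro n _ hn0
    refine Finset.sum_eq_zero fun x _ => ?_
    dsimp only
    by_cases hx : ∃ f ∈ List.ofFn x, f ≠ a1 ∧ f ≠ b1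
    · obtain ⟨f, hf, hf1, hf2⟩ := hx
      have hnone : (preCB f : Option (Bool × K)) = none := by
        rcases f with _ | _ | _ | _ | _ <;> simp_all [preCB]
      rw [show push mCB φ (List.ofFn x) = 0 from
        push_monoSubst_eq_zero_of_mem _ _ _ ⟨f, hf, hnone⟩, mul_zero]
    · push Not at hx
      by_cases ha : a1 ∈ List.ofFn x
      · rw [List.nil_append, subst₂_DK_apply_val, Finset.sum_eq_zero, zero_mul]
        intro j _
        refine Finset.sum_eq_zero fun y _ => ?_
        rw [hψ]
        dsimp only
        rw [castK_apply]
        simp only [lyx, swapL_apply, List.map_append]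
        rw [lxy_apply_prefix_eq_zero ((List.ofFn x).map sw) v p ((List.ofFn y).map sw) hv hp hph
          ?_ ?_]
        · simp
        · intro f hf
          obtain ⟨f', hf', rfl⟩ := List.mem_map.mp hf
          by_cases h1 : f' = a1
          · exact Or.inr (by rw [h1]; rfl)
          · exact Or.inl (by rw [hx f' hf' h1]; rfl)
        · exact List.mem_map.mpr ⟨a1, ha, rfl⟩
      · have hall : ∀ f ∈ List.ofFn x, f = b1 := fun f hf => by
          by_contra hfb
          by_cases h1 : f = a1
          · exact ha (h1 ▸ hf)
          · exact hfb (hx f hf h1)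
        rw [eq_replicate_of_forall hall, List.length_ofFn,
          push_monoSubst_replicate (preCB (K := K)) φ (f := b1) rfl n,
          h0' n (Nat.one_le_iff_ne_zero.mpr hn0)]
        ring

/-- **[Furusho2011, Lemma 5.2 with Lemma 5.1 (d)] `E₁(l^{y,x}_{v,p}) = π_Y(φ)(p v)`** for a
group-like pentagon solution and `p` with head `≥ 2`: transport `E₁ = E₂` along
`φ(d,e) φ(a,b) = φ(c,b) φ(a,e) φ(d,c)` in `U𝔞₄` (`DrinfeldPentagon.eval_point_eq`) through the
representation `ρ_N`. [cite: Furusho2011, Lemmas 5.1, 5.2] -/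
theorem E₁_lyx [Algebra ℚ K] {φ : NCSeries Bool K} (h5 : DrinfeldPentagon φ) (hg : IsGroupLike φ)
    {v p : List ℕ} (hv : ∀ i ∈ v, 1 ≤ i) (hp : ∀ i ∈ p, 1 ≤ i) (hp0 : p ≠ [])
    (hph : ∀ h : p ≠ [], 2 ≤ p.head h) :
    E₁ φ (v.sum + p.sum) (lyx v p) = piY φ (p ++ v) := by
  have h0 : φ [] = 1 := hg.1
  have hX0 : φ [false] = 0 := h5.apply_letter_eq_zero_of_isGroupLike hg false
  have h0' : ∀ k, 1 ≤ k → φ (List.replicate k false) = 0 := fun k hk =>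
    hg.apply_replicate_eq_zero hX0 k (by omega)
  let ψ : VN K (v.sum + p.sum) :=
    mkV (lyx v p) (integrable_lxy' hv hp).2 (homog_lxy' hv hp).2 le_rfl
  rw [E₁_eq_op le_rfl (homog_lxy' hv hp).2 ψ rfl]
  have key := congrArg (fun T => (T ψ).1 []) (congrArg (ρN K (v.sum + p.sum))
    (h5.eval_point_eq hg (v.sum + p.sum)))
  rw [map_mul, map_mul, map_mul, ρN_subst₂, ρN_subst₂, ρN_subst₂, ρN_subst₂, ρN_subst₂, map_add,
    map_add, map_add, map_add, ρN_t₄, ρN_t₄, ρN_t₄, ρN_t₄, ρN_t₄, Dt_d, Dt_e, Dt01, Dt12, Dt23] at key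
  rw [key]
  exact op₂_lyx h0 h0' hv hp hp0 hph le_rfl ψ rfl

end Rep

/-! ## B.5b.11 Assembly: the stuffle relation for `π_Y(φ)` off the corner -/

open MZV (stuffle)

/-- **Organising `s ∗ t` by the cut of `t`**: for `s` nonempty,
`Σ_{u ∈ s ∗ t} G(u) = Σ_{t = q r} Σ_{v ∈ qshHead s r} G(q v)`. [folklore] -/
theorem sum_stuffle_eq_sum_splits_qshHead {M : Type*} [AddCommMonoid M] (e : ℕ) (r' : List ℕ) :
    ∀ (t : List ℕ) (G : List ℕ → M), ((stuffle (e :: r') t).map G).sum =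
      ∑ p ∈ splits t, ((qshHead (e :: r') p.2).map fun v => G (p.1 ++ v)).sum
  | [], G => by simp [sum_splits_nil]
  | x :: q', G => by
    rw [sum_stuffle_cons_cons_eq_qshHead, sum_splits_cons,
      sum_stuffle_eq_sum_splits_qshHead e r' q' (G ∘ List.cons x)]
    simp

/-- Elements of `qshHead s r` are elements of `s ∗ r`. [folklore] -/
theorem mem_stuffle_of_mem_qshHead {e : ℕ} {r' : List ℕ} : ∀ {r v : List ℕ},
    v ∈ qshHead (e :: r') r → v ∈ stuffle (e :: r') r
  | [], v, hv => by simpa using hv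
  | x :: q', v, hv =>
    (stuffle_cons_cons_perm_qshHead e r' x q').symm.mem_iff.mp (List.mem_append_left _ hv)

/-- `Ĝ₁` is group-like. [folklore] -/
theorem isGroupLike_G₁ {φ : NCSeries Bool K} (hg : IsGroupLike φ) : IsGroupLike (G₁ φ) :=
  (hg.push mDE).mul (hg.push mAB)

/-- **[Furusho2011, Lemma 5.1 + series shuffle formula] `E₁` is multiplicative on `l^x_s ш l^y_t`**:
`E₁(l^x_s) E₁(l^y_t) = E₁(Q(s,t))`. [cite: Furusho2011, §5, (5.3)] -/
theorem E₁_lx_mul_E₁_ly {φ : NCSeries Bool K} (hg : IsGroupLike φ) {s t : List ℕ}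
    (hs : ∀ i ∈ s, 1 ≤ i) (ht : ∀ i ∈ t, 1 ≤ i) (hs0 : s ≠ []) (ht0 : t ≠ []) :
    E₁ φ s.sum (lx s) * E₁ φ t.sum (ly t) = E₁ φ (s.sum + t.sum) (Q s t) := by
  rw [E₁_apply, E₁_apply, E₁_apply, ← shuf_lx_ly hs ht hs0 ht0, castK_shuf,
    pairLen_shufK_homog t.sum _ (homog_castK (homog_lx s)) (isGroupLike_G₁ hg)]

/-- **The stuffle relation for `π_Y(φ)` off the corner** [Furusho2011, §5: Lemma 5.1, Lemma 5.2 and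
the display after (5.3), "`l_𝐚(φ) l_𝐛(φ) = Σ_{σ∈Sh^≤(k,l)} l_{σ(𝐚,𝐛)}(φ)` … whenever `b_1 > 1`"]:
for a group-like solution `φ` of Drinfeld's pentagon equation over a commutative `ℚ`-algebra,
`π_Y(φ)(s) π_Y(φ)(t) = Σ_{u ∈ s ∗ t} π_Y(φ)(u)` for every nonempty admissible `s` and every
nonempty `t` with positive entries (reversed-index convention: admissibility of `s` is Furusho's
`b_1 > 1`). [cite: Furusho2011, §5] -/
theorem _root_.Literature.NumberTheory.Transcendental.NCSeries.DrinfeldPentagon.piY_mul_piY_eq_sum_stuffle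
    [Algebra ℚ K] {φ : NCSeries Bool K} (h5 : DrinfeldPentagon φ) (hg : IsGroupLike φ)
    {s t : List ℕ} (hs : MZV.IsAdmissible s) (hs0 : s ≠ []) (ht : ∀ i ∈ t, 1 ≤ i) (ht0 : t ≠ []) :
    piY φ s * piY φ t = ((stuffle s t).map (piY φ)).sum := by
  have h0 : φ [] = 1 := hg.1
  have hX1 : φ [true] = 0 := h5.apply_letter_eq_zero_of_isGroupLike hg true
  have h1' : ∀ k, 1 ≤ k → φ (List.replicate k true) = 0 := fun k hk =>
    hg.apply_replicate_eq_zero hX1 k (by omega)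
  obtain ⟨a, s', rfl⟩ := List.exists_cons_of_ne_nil hs0
  obtain ⟨b, t'', rfl⟩ := List.exists_cons_of_ne_nil ht0
  have ha2 : 2 ≤ a := hs.2 (List.cons_ne_nil _ _)
  obtain ⟨c, rfl⟩ : ∃ c, a = c + 1 := ⟨a - 1, by omega⟩
  obtain ⟨d, rfl⟩ : ∃ d, b = d + 1 := ⟨b - 1, by have := ht (b) (by simp); omega⟩
  have hs' : ∀ i ∈ s', 1 ≤ i := fun i hi => hs.1 i (by simp [hi])
  have ht'' : ∀ i ∈ t'', 1 ≤ i := fun i hi => ht i (by simp [hi])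
  -- Step 1: `π_Y(s) π_Y(t) = E₁(Q(s,t))`
  rw [← E₁_lx h0 h1' hs.1, ← E₁_ly h0 ht (List.cons_ne_nil _ _), E₁_lx_mul_E₁_ly hg hs.1 ht
    (List.cons_ne_nil _ _) (List.cons_ne_nil _ _), Q, map_add, map_add, QA_cons, QB_cons, QC_cons_cons,
    map_sum, map_sum, map_list_sum, List.map_map]
  simp only [map_list_sum, List.map_map]
  -- Step 2: the right-hand side organised in the same way
  rw [MZV.stuffle_cons_cons, List.map_append, List.map_append, List.sum_append, List.sum_append,
    List.map_map, List.map_map, List.map_map, MZV.sum_map_stuffle_comm (piY φ ∘ List.cons (c + 1)) s',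
    sum_stuffle_eq_sum_splits_qshHead (d + 1) t'' s' (piY φ ∘ List.cons (c + 1)),
    sum_stuffle_eq_sum_splits_qshHead (c + 1) s' t'' (piY φ ∘ List.cons (d + 1))]
  -- Step 3: termwise values (Lemma 5.1 (c),(d) and Lemma 5.2)
  have eA : ∀ p ∈ splits t'', ((qshHead ((c + 1) :: s') p.2).map
      (E₁ φ (((c + 1) :: s').sum + ((d + 1) :: t'').sum) ∘ fun v => lxy v ((d + 1) :: p.1))).sum =
      ((qshHead ((c + 1) :: s') p.2).map fun v => (piY φ ∘ List.cons (d + 1)) (p.1 ++ v)).sum := by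
    intro p hp
    refine congrArg List.sum (List.map_congr_left fun v hv => ?_)
    have hv := mem_stuffle_of_mem_qshHead hv
    have hvpos := MZV.one_le_of_mem_stuffle _ _ hs.1 (fun i hi => ht'' i (mem_of_mem_splits_snd hp hi)) v hv
    have hvsum := MZV.sum_of_mem_stuffle _ _ hv
    have hq : ∀ i ∈ (d + 1) :: p.1, 1 ≤ i := List.forall_mem_cons.mpr
      ⟨by omega, fun i hi => ht'' i (mem_of_mem_splits_fst hp hi)⟩
    have hpt : p.1 ++ p.2 = t'' := mem_splits.mp hp
    have hW : ((c + 1) :: s').sum + ((d + 1) :: t'').sum = v.sum + ((d + 1) :: p.1).sum := by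
      rw [← hpt]; simp only [List.sum_cons, List.sum_append] at hvsum ⊢; omega
    simp only [Function.comp_apply]
    rw [hW, E₁_lxy h0 hvpos hq (Or.inr (List.cons_ne_nil _ _)), List.cons_append]
  have eB : ∀ p ∈ splits s', ((qshHead ((d + 1) :: t'') p.2).map
      (E₁ φ (((c + 1) :: s').sum + ((d + 1) :: t'').sum) ∘ fun v => swapL (lxy v ((c + 1) :: p.1)))).sum =
      ((qshHead ((d + 1) :: t'') p.2).map fun v => (piY φ ∘ List.cons (c + 1)) (p.1 ++ v)).sum := by
    intro p hp
    refine congrArg List.sum (List.map_congr_left fun v hv => ?_)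
    have hv := mem_stuffle_of_mem_qshHead hv
    have hvpos := MZV.one_le_of_mem_stuffle _ _ ht (fun i hi => hs' i (mem_of_mem_splits_snd hp hi)) v hv
    have hvsum := MZV.sum_of_mem_stuffle _ _ hv
    have hq : ∀ i ∈ (c + 1) :: p.1, 1 ≤ i := List.forall_mem_cons.mpr
      ⟨by omega, fun i hi => hs' i (mem_of_mem_splits_fst hp hi)⟩
    have hpt : p.1 ++ p.2 = s' := mem_splits.mp hp
    have hW : ((c + 1) :: s').sum + ((d + 1) :: t'').sum = v.sum + ((c + 1) :: p.1).sum := by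
      rw [← hpt]; simp only [List.sum_cons, List.sum_append] at hvsum ⊢; omega
    simp only [Function.comp_apply]
    rw [hW, show swapL (lxy v ((c + 1) :: p.1)) = lyx v ((c + 1) :: p.1) from rfl,
      E₁_lyx h5 hg hvpos hq (List.cons_ne_nil _ _) (fun _ => by show 2 ≤ c + 1; omega),
      List.cons_append]
  have eC : ((stuffle s' t'').map
      (E₁ φ (((c + 1) :: s').sum + ((d + 1) :: t'').sum) ∘ fun w => lxyD ((c + 1 + (d + 1)) :: w))).sum =
      ((stuffle s' t'').map (piY φ ∘ List.cons (c + 1 + (d + 1)))).sum := by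
    refine congrArg List.sum (List.map_congr_left fun w hw => ?_)
    have hwpos := MZV.one_le_of_mem_stuffle _ _ hs' ht'' w hw
    have hwsum := MZV.sum_of_mem_stuffle _ _ hw
    have hu : ∀ i ∈ (c + 1 + (d + 1)) :: w, 1 ≤ i := List.forall_mem_cons.mpr ⟨by omega, hwpos⟩
    have hW : ((c + 1) :: s').sum + ((d + 1) :: t'').sum = ((c + 1 + (d + 1)) :: w).sum := by
      simp only [List.sum_cons] at hwsum ⊢; omega
    simp only [Function.comp_apply]
    rw [hW, E₁_lxyD h0 hu (List.cons_ne_nil _ _)]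
  rw [Finset.sum_congr rfl eA, Finset.sum_congr rfl eB, eC]
  abel

end BarFun

end Literature.NumberTheory.Transcendental
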